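import Mathlib
import Literature.Analysis.FluidPDE.ClassicalSolutionRescale
import Literature.Analysis.FluidPDE.LeraySelfSimilarCalculus
import HarnessLib

/-!
# The free-space zeroth-law rescaling `u ↦ μ^{2/3} u(μ ·)` of steady Navier–Stokes solutions

Analysis/FluidPDE support file (everything proved; no definitions, no named facts). The
Navier–Stokes system is covariant under the two-parameter family of space dilations
`u ↦ a u(μ ·)`, `p ↦ a² p(μ ·)`, `f ↦ a² μ f(μ ·)`, `ν ↦ a ν / μ` (`a, μ > 0`; tree:
`IsClassicalNSSolutionOn.stRescale`, Leray 1934, §20), i.e. under Frisch's scaling group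
`(x, u, ν) ↦ (λ x, λ^h u, λ^{1+h} ν)` (Frisch 1995, §2.2, with `λ = μ⁻¹`, `a = λ^h`). On `ℝ³` the
exponent `h = -2/3` (`a = μ^{2/3}`, viscosity `μ^{-1/3} ν`) is singled out by the invariance of the
TOTAL dissipation `ν ∫ |∇u|²` (the exponent `h = 1/3` of Kolmogorov 1941 keeps the dissipation per
unit mass): since `∇(μ^{2/3} u(μ ·)) = μ^{5/3} (∇u)(μ ·)` and `dy = μ^{-3} dx`,
`μ^{-1/3} ν ∫ |∇(μ^{2/3} u(μ ·))|² = ν ∫ |∇u|²`. Along this family the viscosity tends to zero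
(`μ → ∞`) at constant dissipation: a single steady solution `Q` of the unit-viscosity system with
`∫|∇Q|² < ∞` and mass envelope `∫_{B_R}|Q|² ≤ C R^{5/3}` is a whole vanishing-viscosity family
`(μ^{2/3} Q(μ ·), μ^{-1/3})` of steady solutions with `μ`-independent dissipation and energy
`∫_{B_r} |μ^{2/3} Q(μ ·)|² ≤ C r^{5/3}` (`μ r ≥ 1`) — the free-space, "fed from infinity" form of
the zeroth law of turbulence (Frisch 1995, §5.2; Doering–Foias 2002, §1: the dissipation rate stays
of order `U³/L` as `ν → 0`). This file records the bookkeeping: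

* `frobeniusNormSq_fderiv_const_smul_comp_smul` — `|∇(a Q(μ ·))|²(y) = (a μ)² |∇Q|²(μ y)`
  (any normed spaces; the chain rule is the tree's `fderiv_const_smul_comp_smul'`);
* `integrable_frobeniusNormSq_fderiv_const_smul_comp_smul`,
  `setIntegral_frobeniusNormSq_fderiv_const_smul_comp_smul` — integrability and the dilation of
  the dissipation on a set (`∫_s |∇(a Q(μ ·))|² = (a μ)² μ^{-d} ∫_{μ • s} |∇Q|²`);
* on `ℝ³` with `a = μ^{2/3}`: `zerothLaw_setIntegral_dissipation` (any set),
  `zerothLaw_integral_dissipation` (whole space: `μ^{-1/3} ∫ |∇(μ^{2/3}Q(μ ·))|² = ∫ |∇Q|²`),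
  `zerothLaw_exterior_dissipation` (exterior regions `{r ≤ |y|} ↦ {μ r ≤ |x|}`, the form in which the
  dissipation of the family concentrates at the origin), `zerothLaw_setIntegral_ball_norm_sq(_le)`
  (mass of the family on balls, and its uniform bound under the envelope `∫_{B_R}|Q|² ≤ C R^{5/3}`);
* `IsClassicalNSSolutionOn.zerothLawRescale(_one)` — the rescaled pair
  `(μ^{2/3} Q(μ ·), μ^{4/3} P(μ ·))` of a steady zero-force classical solution at viscosity `ν` is a
  steady zero-force classical solution at viscosity `μ^{-1/3} ν` (any finite-dimensional space).

## Mathlib / tree search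

Mathlib: `fderiv_comp_smul`, `Measure.setIntegral_comp_smul_of_pos`, `integrable_comp_smul_iff`,
`smul_ball`; tree: `fderiv_const_smul_comp_smul'` (`LeraySelfSimilarCalculus`),
`frobeniusNormSq_const_smul` (`NSViscosityRescaling`), `IsClassicalNSSolutionOn.stRescale`
(`ClassicalSolutionRescale`). The summit-side stub `PointSinkConeDesingularisationStubBlowdownCovariance`
proves the unit-ball instance of `zerothLaw_setIntegral_dissipation` for the steady notion
`IsSteadyClassicalNS`; nothing Literature-side (`lean search 'zerothLaw|FreeSpaceZerothLaw'`).

## References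

* U. Frisch, *Turbulence: The Legacy of A. N. Kolmogorov*, Cambridge University Press (1995), §2.2
  (scaling symmetries `h`, `ν ↦ λ^{1+h} ν`), §5.2 (the dissipation anomaly). [Frisch1995]
* C. R. Doering, C. Foias, *Energy dissipation in body-forced turbulence*, J. Fluid Mech. 467 (2002)
  289–306, §1. [DoeringFoias2002JFM]
* J. Leray, *Sur le mouvement d'un liquide visqueux emplissant l'espace*, Acta Math. 63 (1934), §20.
  [Leray1934]
-/

noncomputable section

open MeasureTheory Set Metric
open scoped Pointwise

namespace Literature.Analysis.FluidPDE

/-! ### Dilation of the dissipation density (any dimension) -/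

section General

variable {E : Type*} [NormedAddCommGroup E] [InnerProductSpace ℝ E] [FiniteDimensional ℝ E]
variable {F : Type*} [NormedAddCommGroup F] [InnerProductSpace ℝ F]

/-- **Dissipation density under dilation.** `|∇(a Q(μ ·))|²(y) = (a μ)² |∇Q|²(μ y)` for all
`a μ : ℝ`, with no differentiability hypothesis (`∇(a Q(μ ·))(y) = (a μ) • (∇Q)(μ y)`, the tree's
`fderiv_const_smul_comp_smul'`, and `|c L|² = c² |L|²`, `frobeniusNormSq_const_smul`). [folklore] -/
theorem frobeniusNormSq_fderiv_const_smul_comp_smul (Q : E → F) (a μ : ℝ) (y : E) :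
    frobeniusNormSq (fderiv ℝ (fun y => a • Q (μ • y)) y) =
      (a * μ) ^ 2 * frobeniusNormSq (fderiv ℝ Q (μ • y)) := by
  rw [fderiv_const_smul_comp_smul', frobeniusNormSq_const_smul]

variable [MeasurableSpace E] [BorelSpace E]

/-- **Integrable dissipation under dilation.** If `|∇Q|²` is integrable then so is
`|∇(a Q(μ ·))|² = (a μ)² |∇Q|²(μ ·)` for `μ ≠ 0` (`Integrable.comp_smul`). [folklore] -/
theorem integrable_frobeniusNormSq_fderiv_const_smul_comp_smul {Q : E → F}
    (hQ : Integrable (fun x => frobeniusNormSq (fderiv ℝ Q x))) (a : ℝ) {μ : ℝ} (hμ : μ ≠ 0) :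
    Integrable (fun y => frobeniusNormSq (fderiv ℝ (fun y => a • Q (μ • y)) y)) := by
  simp_rw [frobeniusNormSq_fderiv_const_smul_comp_smul]
  exact (hQ.comp_smul hμ).const_mul _

/-- **Dilation of the dissipation on a set.** For `μ > 0` and any set `s`,
`∫_s |∇(a Q(μ ·))|² = (a μ)² μ^{-d} ∫_{μ • s} |∇Q|²` (`d = dim E`; change of variables
`Measure.setIntegral_comp_smul_of_pos`, no integrability needed). [folklore] -/
theorem setIntegral_frobeniusNormSq_fderiv_const_smul_comp_smul (Q : E → F) (a : ℝ) {μ : ℝ}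
    (hμ : 0 < μ) (s : Set E) :
    ∫ y in s, frobeniusNormSq (fderiv ℝ (fun y => a • Q (μ • y)) y) =
      (a * μ) ^ 2 * (μ ^ Module.finrank ℝ E)⁻¹ * ∫ x in μ • s, frobeniusNormSq (fderiv ℝ Q x) := by
  simp_rw [frobeniusNormSq_fderiv_const_smul_comp_smul]
  rw [integral_const_mul, Measure.setIntegral_comp_smul_of_pos volume
    (fun x => frobeniusNormSq (fderiv ℝ Q x)) s hμ, smul_eq_mul, mul_assoc]

end General

/-! ### The steady zero-force system under the zeroth-law rescaling (any dimension) -/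

section Solution

variable {E : Type*} [NormedAddCommGroup E] [InnerProductSpace ℝ E] [FiniteDimensional ℝ E]

/-- `(μ^{2/3})² = μ^{4/3}` for `μ ≥ 0`. [folklore] -/
theorem rpow_two_thirds_sq {μ : ℝ} (hμ : 0 ≤ μ) : (μ ^ (2 / 3 : ℝ)) ^ 2 = μ ^ (4 / 3 : ℝ) := by
  rw [← Real.rpow_mul_natCast hμ]
  norm_num

/-- **Zeroth-law rescaling of steady classical solutions.** If `(Q, P)` is a steady classical
solution of the zero-force Navier–Stokes system at viscosity `ν` on a finite-dimensional space, then
for `μ > 0` the pair `(μ^{2/3} Q(μ ·), μ^{4/3} P(μ ·))` is a steady classical solution of the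
zero-force system at viscosity `μ^{-1/3} ν` (`IsClassicalNSSolutionOn.stRescale` with `α = μ^{2/3}`,
`γ = μ`, `β = αγ`: viscosity `α ν / γ = μ^{-1/3} ν`, pressure amplitude `α² = μ^{4/3}`; Leray 1934,
§20; Frisch 1995, §2.2 with `h = -2/3`). [folklore] -/
theorem IsClassicalNSSolutionOn.zerothLawRescale {Q : E → E} {P : E → ℝ} {ν : ℝ}
    (h : IsClassicalNSSolutionOn Set.univ ν (fun _ _ => 0) (fun _ => Q) (fun _ => P)) {μ : ℝ}
    (hμ : 0 < μ) :
    IsClassicalNSSolutionOn Set.univ (μ ^ (-(1 / 3 : ℝ)) * ν) (fun _ _ => 0)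
      (fun _ y => μ ^ (2 / 3 : ℝ) • Q (μ • y)) (fun _ y => μ ^ (4 / 3 : ℝ) * P (μ • y)) := by
  have hα : 0 < μ ^ (2 / 3 : ℝ) := Real.rpow_pos_of_pos hμ _
  have key := h.stRescale hα hμ rfl 0 0
  have hν : μ ^ (2 / 3 : ℝ) * ν / μ = μ ^ (-(1 / 3 : ℝ)) * ν := by
    rw [mul_div_right_comm, ← Real.rpow_sub_one hμ.ne']
    norm_num
  have hf : (((μ ^ (2 / 3 : ℝ)) ^ 2 * μ) • stPull (μ ^ (2 / 3 : ℝ) * μ) μ 0 (0 : E)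
      (fun (_ : ℝ) (_ : E) => (0 : E))) = fun _ _ => 0 := by
    funext t x
    simp [stPull_apply]
  have hu : ((μ ^ (2 / 3 : ℝ)) • stPull (μ ^ (2 / 3 : ℝ) * μ) μ 0 (0 : E) (fun _ : ℝ => Q)) =
      fun _ x => μ ^ (2 / 3 : ℝ) • Q (μ • x) := by
    funext t x
    simp [stPull_apply]
  have hp : ((μ ^ (2 / 3 : ℝ)) ^ 2 • stPull (μ ^ (2 / 3 : ℝ) * μ) μ 0 (0 : E) (fun _ : ℝ => P)) =
      fun _ x => μ ^ (4 / 3 : ℝ) * P (μ • x) := by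
    funext t x
    simp only [Pi.smul_apply, stPull_apply, zero_add, smul_eq_mul]
    rw [rpow_two_thirds_sq hμ.le]
  rw [Set.preimage_univ, hν, hf, hu, hp] at key
  exact key

/-- **Zeroth-law rescaling, unit viscosity.** For a steady classical zero-force solution `(Q, P)`
at viscosity `1` and `μ > 0`, `(μ^{2/3} Q(μ ·), μ^{4/3} P(μ ·))` is a steady classical zero-force
solution at viscosity `μ^{-1/3}` (Frisch 1995, §2.2, `h = -2/3`). [folklore] -/
theorem IsClassicalNSSolutionOn.zerothLawRescale_one {Q : E → E} {P : E → ℝ}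
    (h : IsClassicalNSSolutionOn Set.univ 1 (fun _ _ => 0) (fun _ => Q) (fun _ => P)) {μ : ℝ}
    (hμ : 0 < μ) :
    IsClassicalNSSolutionOn Set.univ (μ ^ (-(1 / 3 : ℝ))) (fun _ _ => 0)
      (fun _ y => μ ^ (2 / 3 : ℝ) • Q (μ • y)) (fun _ y => μ ^ (4 / 3 : ℝ) * P (μ • y)) := by
  simpa only [mul_one] using h.zerothLawRescale hμ

end Solution

/-! ### The dissipation and the mass of the family on `ℝ³` -/

section ThreeSpace

/-- Dissipation bookkeeping on `ℝ³`: `μ^{-1/3} ((μ^{2/3} μ)² μ^{-3}) = 1` for `μ > 0`. [folklore] -/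
theorem zerothLaw_rpow_dissipation {μ : ℝ} (hμ : 0 < μ) :
    μ ^ (-(1 / 3 : ℝ)) * ((μ ^ (2 / 3 : ℝ) * μ) ^ 2 * (μ ^ 3)⁻¹) = 1 := by
  have h1 : μ ^ (-(1 / 3 : ℝ)) * (μ ^ (2 / 3 : ℝ)) ^ 2 = μ := by
    rw [rpow_two_thirds_sq hμ.le, ← Real.rpow_add hμ]
    norm_num
  have h2 : μ * μ ^ 2 = μ ^ 3 := by ring
  calc μ ^ (-(1 / 3 : ℝ)) * ((μ ^ (2 / 3 : ℝ) * μ) ^ 2 * (μ ^ 3)⁻¹)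
      = μ ^ (-(1 / 3 : ℝ)) * (μ ^ (2 / 3 : ℝ)) ^ 2 * μ ^ 2 * (μ ^ 3)⁻¹ := by ring
    _ = 1 := by rw [h1, h2, mul_inv_cancel₀ (pow_ne_zero 3 hμ.ne')]

/-- Mass bookkeeping on `ℝ³`: `(μ^{2/3})² μ^{-3} μ^{5/3} = 1` for `μ > 0`. [folklore] -/
theorem zerothLaw_rpow_mass {μ : ℝ} (hμ : 0 < μ) :
    (μ ^ (2 / 3 : ℝ)) ^ 2 * (μ ^ 3)⁻¹ * μ ^ (5 / 3 : ℝ) = 1 := by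
  have h1 : (μ ^ (2 / 3 : ℝ)) ^ 2 * μ ^ (5 / 3 : ℝ) = μ ^ 3 := by
    rw [rpow_two_thirds_sq hμ.le, ← Real.rpow_add hμ,
      show (4 / 3 : ℝ) + 5 / 3 = ((3 : ℕ) : ℝ) by norm_num, Real.rpow_natCast]
  rw [mul_right_comm, h1, mul_inv_cancel₀ (pow_ne_zero 3 hμ.ne')]

/-- **The free-space zeroth law on a set.** For `μ > 0` and any `s ⊆ ℝ³`,
`μ^{-1/3} ∫_s |∇(μ^{2/3} Q(μ ·))|² = ∫_{μ • s} |∇Q|²`: the dissipation of the rescaled field at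
viscosity `μ^{-1/3}` on `s` is the dissipation of `Q` at viscosity `1` on `μ • s`
(`μ^{-1/3 + 10/3 - 3} = 1`; Frisch 1995, §2.2, `h = -2/3`). [folklore] -/
theorem zerothLaw_setIntegral_dissipation (Q : EuclideanSpace ℝ (Fin 3) → EuclideanSpace ℝ (Fin 3))
    {μ : ℝ} (hμ : 0 < μ) (s : Set (EuclideanSpace ℝ (Fin 3))) :
    μ ^ (-(1 / 3 : ℝ)) *
        ∫ y in s, frobeniusNormSq (fderiv ℝ (fun y => μ ^ (2 / 3 : ℝ) • Q (μ • y)) y) =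
      ∫ x in μ • s, frobeniusNormSq (fderiv ℝ Q x) := by
  rw [setIntegral_frobeniusNormSq_fderiv_const_smul_comp_smul Q _ hμ, finrank_euclideanSpace_fin,
    ← mul_assoc, zerothLaw_rpow_dissipation hμ, one_mul]

/-- **The free-space zeroth law.** For `μ > 0`, `μ^{-1/3} ∫ |∇(μ^{2/3} Q(μ ·))|² = ∫ |∇Q|²` on `ℝ³`:
the total dissipation of the family `(μ^{2/3} Q(μ ·), ν = μ^{-1/3})` does not depend on the
viscosity (Frisch 1995, §§2.2, 5.2; Doering–Foias 2002, §1). [folklore] -/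
theorem zerothLaw_integral_dissipation (Q : EuclideanSpace ℝ (Fin 3) → EuclideanSpace ℝ (Fin 3))
    {μ : ℝ} (hμ : 0 < μ) :
    μ ^ (-(1 / 3 : ℝ)) * ∫ y, frobeniusNormSq (fderiv ℝ (fun y => μ ^ (2 / 3 : ℝ) • Q (μ • y)) y) =
      ∫ x, frobeniusNormSq (fderiv ℝ Q x) := by
  have h := zerothLaw_setIntegral_dissipation Q hμ Set.univ
  rwa [Set.smul_set_univ₀ hμ.ne', Measure.restrict_univ] at h

/-- A dilation by `c > 0` maps the exterior region `r ≤ |x|` of `ℝ³` onto `c r ≤ |y|`. [folklore] -/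
theorem smul_setOf_le_norm {c : ℝ} (hc : 0 < c) (r : ℝ) :
    c • {x : EuclideanSpace ℝ (Fin 3) | r ≤ ‖x‖} = {y : EuclideanSpace ℝ (Fin 3) | c * r ≤ ‖y‖} := by
  ext y
  rw [Set.mem_smul_set_iff_inv_smul_mem₀ hc.ne', Set.mem_setOf_eq, Set.mem_setOf_eq, norm_smul,
    norm_inv, Real.norm_eq_abs, abs_of_pos hc, le_inv_mul_iff₀ hc]

/-- **The free-space zeroth law on exterior regions.** For `μ > 0` and `r : ℝ`,
`μ^{-1/3} ∫_{r ≤ |y|} |∇(μ^{2/3} Q(μ ·))|² = ∫_{μ r ≤ |x|} |∇Q|²`: as `μ → ∞` the dissipation of the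
family escapes every exterior region, i.e. concentrates at the origin. [folklore] -/
theorem zerothLaw_exterior_dissipation (Q : EuclideanSpace ℝ (Fin 3) → EuclideanSpace ℝ (Fin 3))
    {μ : ℝ} (hμ : 0 < μ) (r : ℝ) :
    μ ^ (-(1 / 3 : ℝ)) * ∫ y in {y : EuclideanSpace ℝ (Fin 3) | r ≤ ‖y‖},
        frobeniusNormSq (fderiv ℝ (fun y => μ ^ (2 / 3 : ℝ) • Q (μ • y)) y) =
      ∫ x in {x : EuclideanSpace ℝ (Fin 3) | μ * r ≤ ‖x‖}, frobeniusNormSq (fderiv ℝ Q x) := by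
  rw [zerothLaw_setIntegral_dissipation Q hμ, smul_setOf_le_norm hμ]

/-- **Mass of the family on balls.** For `μ > 0`,
`∫_{B_r} |μ^{2/3} Q(μ y)|² dy = (μ^{2/3})² μ^{-3} ∫_{B_{μ r}} |Q|²` (change of variables; no
integrability needed). [folklore] -/
theorem zerothLaw_setIntegral_ball_norm_sq (Q : EuclideanSpace ℝ (Fin 3) → EuclideanSpace ℝ (Fin 3))
    {μ : ℝ} (hμ : 0 < μ) (r : ℝ) :
    ∫ y in ball (0 : EuclideanSpace ℝ (Fin 3)) r, ‖μ ^ (2 / 3 : ℝ) • Q (μ • y)‖ ^ 2 =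
      (μ ^ (2 / 3 : ℝ)) ^ 2 * (μ ^ 3)⁻¹ *
        ∫ x in ball (0 : EuclideanSpace ℝ (Fin 3)) (μ * r), ‖Q x‖ ^ 2 := by
  have ha : 0 ≤ μ ^ (2 / 3 : ℝ) := Real.rpow_nonneg hμ.le _
  have hfun : (fun y : EuclideanSpace ℝ (Fin 3) => ‖μ ^ (2 / 3 : ℝ) • Q (μ • y)‖ ^ 2) =
      fun y => (μ ^ (2 / 3 : ℝ)) ^ 2 * ‖Q (μ • y)‖ ^ 2 := by
    funext y
    rw [norm_smul, mul_pow, Real.norm_of_nonneg ha]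
  rw [hfun, integral_const_mul, Measure.setIntegral_comp_smul_of_pos volume
      (fun x : EuclideanSpace ℝ (Fin 3) => ‖Q x‖ ^ 2) _ hμ,
    _root_.smul_ball hμ.ne', smul_zero, Real.norm_of_nonneg hμ.le, finrank_euclideanSpace_fin,
    smul_eq_mul, mul_assoc]

/-- **Uniform energy of the family in small balls.** Under the mass envelope
`∫_{B_R} |Q|² ≤ C R^{5/3}` (`R ≥ 1`), for `r > 0`, `μ > 0` with `μ r ≥ 1`:
`∫_{B_r} |μ^{2/3} Q(μ y)|² dy ≤ C r^{5/3}` — uniformly in `μ` (`(μ^{2/3})² μ^{-3} (μ r)^{5/3} =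
r^{5/3}`): the bounded-energy clause of the free-space zeroth law (Doering–Foias 2002, §1). [folklore] -/
theorem zerothLaw_setIntegral_ball_norm_sq_le
    {Q : EuclideanSpace ℝ (Fin 3) → EuclideanSpace ℝ (Fin 3)} {C r μ : ℝ}
    (hmass : ∀ R : ℝ, 1 ≤ R →
      ∫ x in ball (0 : EuclideanSpace ℝ (Fin 3)) R, ‖Q x‖ ^ 2 ≤ C * R ^ (5 / 3 : ℝ))
    (hr : 0 < r) (hμ : 0 < μ) (h1 : 1 ≤ μ * r) :
    ∫ y in ball (0 : EuclideanSpace ℝ (Fin 3)) r, ‖μ ^ (2 / 3 : ℝ) • Q (μ • y)‖ ^ 2 ≤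
      C * r ^ (5 / 3 : ℝ) := by
  rw [zerothLaw_setIntegral_ball_norm_sq Q hμ r]
  have hμ3 : 0 ≤ (μ ^ (2 / 3 : ℝ)) ^ 2 * (μ ^ 3)⁻¹ :=
    mul_nonneg (sq_nonneg _) (inv_nonneg.2 (pow_nonneg hμ.le 3))
  calc (μ ^ (2 / 3 : ℝ)) ^ 2 * (μ ^ 3)⁻¹ *
        ∫ x in ball (0 : EuclideanSpace ℝ (Fin 3)) (μ * r), ‖Q x‖ ^ 2
      ≤ (μ ^ (2 / 3 : ℝ)) ^ 2 * (μ ^ 3)⁻¹ * (C * (μ * r) ^ (5 / 3 : ℝ)) :=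
        mul_le_mul_of_nonneg_left (hmass (μ * r) h1) hμ3
    _ = C * r ^ (5 / 3 : ℝ) * ((μ ^ (2 / 3 : ℝ)) ^ 2 * (μ ^ 3)⁻¹ * μ ^ (5 / 3 : ℝ)) := by
        rw [Real.mul_rpow hμ.le hr.le]; ring
    _ = C * r ^ (5 / 3 : ℝ) := by rw [zerothLaw_rpow_mass hμ, mul_one]

end ThreeSpace

end Literature.Analysis.FluidPDE

end
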